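import Mathlib.Combinatorics.SimpleGraph.Walk.Counting
import Mathlib.Combinatorics.SimpleGraph.Paths
import Mathlib.Combinatorics.SimpleGraph.Operations
import Mathlib.Topology.Algebra.InfiniteSum.ENNReal
import Summits.CriticalPhenomena.SAWScalingLimit.Theorems.SAWTotalPositivityBoundaryTP2Defs
import Summits.CriticalPhenomena.SAWScalingLimit.Theorems.SAWTotalPositivityBoundaryTP2Kernel
import Summits.CriticalPhenomena.SAWScalingLimit.Theorems.SAWTotalPositivityBoundaryTP2Symmetry
import Summits.CriticalPhenomena.SAWScalingLimit.Theorems.SAWTotalPositivityBoundaryTP2FirstStep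
import Summits.CriticalPhenomena.SAWScalingLimit.Theorems.SAWTotalPositivityBoundaryTP2Avoid
import HarnessLib

/-!
# Crux `BoundaryTP2` (stmt-CriticalPhenomena-7115), line `Sketch`: the unit-square gadget —
the core implies a uniform two-point bound `Z_B(w,w') ≤ 1`

A necessary condition of the crux's combinatorial core `GraphTP2At x` (TP₂ of the fugacity-`x`
self-avoiding path kernel on every finite subgraph of `ℤ²`, `Defs` module), for `0 < x < 1`:
for every `B ≤ zdGraph 2` with finitely many non-isolated vertices and every edge `w w'` of `B` whose
outer unit square `w u u' w'` has its two far corners `u, u'` isolated in `B`,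

  `Z_B(w, w') ≤ 1`        (`pathKernel_le_one_of_graphTP2At`).

Proof (the *square gadget*): hang the three lattice edges `w u`, `u u'`, `u' w'` on `B`, obtaining
`H ≤ zdGraph 2`. In `H` the new vertices `u`, `u'` have exactly the neighbours `{w, u'}` and `{u, w'}`, so
the quadruple `(u, w, w', u')` is interlaced (the last step of a path into `u'` comes from `u` or from `w'`)
and both nested pairings are realised by single edges; `GraphTP2At x` gives
`Z_H(u,w') Z_H(w,u') ≤ Z_H(u,w) Z_H(w',u')`. Two first-step decompositions (`stub_pathKernel_firstStep`)
and the dictionary "paths avoiding a vertex = paths of the vertex-deleted graph" (`stub_pathKernelOn_avoid`)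
evaluate the four kernels exactly in terms of `z = Z_B(w,w')`:
`Z_H(u,w) = Z_H(u',w') = x (1 + x z)` and `Z_H(u,w') = Z_H(u',w) = x (x + z)`, so the inequality reads
`(x + z)² ≤ (1 + x z)²`, i.e. `(1 - x)(z - 1) ≤ 0`, i.e. `z ≤ 1`. Contrapositively a single finite `B ≤ ℤ²`
with `Z_B^{x_c}(w,w') > 1` at such an edge refutes the core at `x_c` (and the crux, through
`tp2_induced_of_boundaryTP2`, when the enlarged graph is induced). Numerically `sup_B Z_B^{x_c}(w,w') ≈ 0.7`
(boxes: boundary-adjacent pairs `≤ 0.49`), a wide margin; the point is that the crux CONTAINS a uniform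
critical two-point bound of `CriticalBubbleBound` type. Everything here is proved. [folklore]
-/

noncomputable section

namespace Summit.CriticalPhenomena.SAWScalingLimit.Theorems.BoundaryTP2

open Literature.Probability.LatticeModels
open scoped ENNReal

variable {V : Type*}

/-! ## Walks at a pendant or isolated vertex (after `…PendantThreePoint`) -/

/-- If every neighbour of `ℓ` equals `c`, a walk from `ℓ` not visiting `c` is trivial. [folklore] -/
private theorem sq_eq_of_walk_from_leaf {G : SimpleGraph V} {ℓ c : V}
    (hleaf : ∀ z, G.Adj ℓ z → z = c) {v : V} (δ : G.Walk ℓ v) (hc : c ∉ δ.support) : ℓ = v := by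
  cases δ with
  | nil => rfl
  | cons h δ' =>
    rw [SimpleGraph.Walk.support_cons, List.mem_cons, not_or] at hc
    obtain rfl := hleaf _ h
    exact absurd δ'.start_mem_support hc.2

/-- A vertex `ℓ` all of whose neighbours equal `c` (a leaf, or an isolated vertex) lying on a self-avoiding
path is one of its endpoints: if it is not the final vertex, it is the initial one. [folklore] -/
private theorem sq_leaf_eq_start_of_mem_support {G : SimpleGraph V} {ℓ c : V}
    (hleaf : ∀ z, G.Adj ℓ z → z = c) :
    ∀ {u v : V} (δ : G.Walk u v), δ.IsPath → ℓ ≠ v → ℓ ∈ δ.support → ℓ = u := by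
  intro u v δ
  induction δ with
  | nil =>
    intro _ _ hmem
    rwa [SimpleGraph.Walk.support_nil, List.mem_singleton] at hmem
  | cons h δ' ih =>
    intro hpath hne hmem
    rw [SimpleGraph.Walk.cons_isPath_iff] at hpath
    rw [SimpleGraph.Walk.support_cons, List.mem_cons] at hmem
    rcases hmem with hmem | hmem
    · exact hmem
    · obtain rfl := ih hpath.1 hne hmem
      obtain rfl := hleaf _ h.symm
      exact absurd (sq_eq_of_walk_from_leaf hleaf δ' hpath.2) hne

/-! ## Generic kernel identities: vertex deletion, leaves, first step at a vertex of degree ≤ 2 -/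

/-- Adjacency of the vertex-deleted graph `H - c = H.deleteEdges (H.incidenceSet c)`. [folklore] -/
theorem deleteEdges_incidenceSet_adj (H : SimpleGraph V) (c a b : V) :
    (H.deleteEdges (H.incidenceSet c)).Adj a b ↔ H.Adj a b ∧ a ≠ c ∧ b ≠ c := by
  rw [SimpleGraph.deleteEdges_adj]
  constructor
  · rintro ⟨hab, hn⟩
    refine ⟨hab, fun h => hn ?_, fun h => hn ?_⟩
    · subst h; exact ⟨(SimpleGraph.mem_edgeSet H).2 hab, Sym2.mem_mk_left _ _⟩
    · subst h; exact ⟨(SimpleGraph.mem_edgeSet H).2 hab, Sym2.mem_mk_right _ _⟩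
  · rintro ⟨hab, hac, hbc⟩
    refine ⟨hab, fun h => ?_⟩
    rcases Sym2.mem_iff.1 h.2 with h | h
    · exact hac h.symm
    · exact hbc h.symm

/-- **Paths between two other vertices never visit a leaf (or an isolated vertex).** If every neighbour of
`ℓ` equals `c` and `a ≠ ℓ`, `b ≠ ℓ`, then `Z_G(a,b) = Z_{G-ℓ}(a,b)`. [folklore] -/
theorem pathKernel_eq_deleteVert_of_leaf (G : SimpleGraph V) (x : ℝ) {ℓ c a b : V}
    (hleaf : ∀ z, G.Adj ℓ z → z = c) (ha : a ≠ ℓ) (hb : b ≠ ℓ) :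
    pathKernel G x a b = pathKernel (G.deleteEdges (G.incidenceSet ℓ)) x a b := by
  rw [← stub_pathKernelOn_avoid G x a b ℓ ha hb]
  unfold pathKernel pathKernelOn
  refine tsum_congr fun γ => ?_
  rw [Set.indicator_of_mem]
  intro hmem
  exact ha (sq_leaf_eq_start_of_mem_support hleaf γ.1 γ.2 hb.symm hmem).symm

/-- **First step at a vertex with exactly two neighbours.** If `N_H(a) = {v₁, v₂}` with `v₁ ≠ v₂` and
`a ≠ b`, then `Z_H(a,b) = x · (Z_{H-a}(v₁,b) + Z_{H-a}(v₂,b))` (`0 ≤ x`). [folklore] -/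
theorem pathKernel_firstStep_pair [DecidableEq V] (H : SimpleGraph V) (x : ℝ) (hx : 0 ≤ x)
    {a b v₁ v₂ : V} (hab : a ≠ b) (hv : v₁ ≠ v₂) (hN : H.neighborSet a = {v₁, v₂}) :
    pathKernel H x a b = ENNReal.ofReal x *
      (pathKernel (H.deleteEdges (H.incidenceSet a)) x v₁ b +
        pathKernel (H.deleteEdges (H.incidenceSet a)) x v₂ b) := by
  have h₁ : H.Adj a v₁ := by rw [← SimpleGraph.mem_neighborSet, hN]; exact Set.mem_insert _ _
  have h₂ : H.Adj a v₂ := by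
    rw [← SimpleGraph.mem_neighborSet, hN]; exact Set.mem_insert_of_mem _ (Set.mem_singleton _)
  rw [stub_pathKernel_firstStep H x hx a b hab]
  congr 1
  set f : V → ℝ≥0∞ := fun u => pathKernelOn H x u b {γ | a ∉ γ.1.support} with hf
  have hcoe : H.neighborSet a = ((({v₁, v₂} : Finset V) : Set V)) := by rw [hN, Finset.coe_pair]
  calc ∑' u : H.neighborSet a, pathKernelOn H x u b {γ | a ∉ γ.1.support}
      = ∑' u : H.neighborSet a, f u := rfl
    _ = ∑' u : ((({v₁, v₂} : Finset V) : Set V)), f u := tsum_congr_set_coe f hcoe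
    _ = ∑ u ∈ ({v₁, v₂} : Finset V), f u := Finset.tsum_subtype' _ f
    _ = f v₁ + f v₂ := Finset.sum_pair hv
    _ = _ := by
        simp only [hf]
        rw [stub_pathKernelOn_avoid H x v₁ b a h₁.ne.symm hab.symm,
          stub_pathKernelOn_avoid H x v₂ b a h₂.ne.symm hab.symm]

/-- **First step at a leaf.** If `N_H(a) = {v}` and `a ≠ b`, then `Z_H(a,b) = x · Z_{H-a}(v,b)`
(`0 ≤ x`). [folklore] -/
theorem pathKernel_firstStep_single (H : SimpleGraph V) (x : ℝ) (hx : 0 ≤ x)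
    {a b v : V} (hab : a ≠ b) (hN : H.neighborSet a = {v}) :
    pathKernel H x a b =
      ENNReal.ofReal x * pathKernel (H.deleteEdges (H.incidenceSet a)) x v b := by
  classical
  have h₁ : H.Adj a v := by rw [← SimpleGraph.mem_neighborSet, hN]; exact Set.mem_singleton _
  rw [stub_pathKernel_firstStep H x hx a b hab]
  congr 1
  set f : V → ℝ≥0∞ := fun u => pathKernelOn H x u b {γ | a ∉ γ.1.support} with hf
  have hcoe : H.neighborSet a = ((({v} : Finset V) : Set V)) := by rw [hN, Finset.coe_singleton]
  calc ∑' u : H.neighborSet a, pathKernelOn H x u b {γ | a ∉ γ.1.support}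
      = ∑' u : H.neighborSet a, f u := rfl
    _ = ∑' u : ((({v} : Finset V) : Set V)), f u := tsum_congr_set_coe f hcoe
    _ = ∑ u ∈ ({v} : Finset V), f u := Finset.tsum_subtype' _ f
    _ = f v := Finset.sum_singleton f v
    _ = _ := by
        simp only [hf]
        rw [stub_pathKernelOn_avoid H x v b a h₁.ne.symm hab.symm]

/-! ## The square gadget -/

/-- Adjacency of the gadget graph: `B` with the three edges `w u`, `u u'`, `u' w'` hung on it. [folklore] -/
private theorem gadget_adj (B : SimpleGraph (Site 2)) (w w' u u' a b : Site 2) :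
    (B ⊔ SimpleGraph.edge w u ⊔ SimpleGraph.edge u u' ⊔ SimpleGraph.edge u' w').Adj a b ↔
      B.Adj a b ∨ ((a = w ∧ b = u ∨ a = u ∧ b = w) ∧ a ≠ b) ∨
        ((a = u ∧ b = u' ∨ a = u' ∧ b = u) ∧ a ≠ b) ∨ ((a = u' ∧ b = w' ∨ a = w' ∧ b = u') ∧ a ≠ b) := by
  simp only [SimpleGraph.sup_adj, SimpleGraph.edge_adj, or_assoc]

/-- **The square gadget.** For `0 < x < 1`, the core `GraphTP2At x` forces `Z_B(w,w') ≤ 1` for every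
`B ≤ ℤ²` with finitely many non-isolated vertices and every edge `w w'` of `B` closing a lattice unit
square `w u u' w'` whose far corners `u, u'` are isolated in `B`. See the module docstring for the
proof. [folklore] -/
theorem pathKernel_le_one_of_graphTP2At {x : ℝ} (hx0 : 0 < x) (hx1 : x < 1) (h : GraphTP2At x)
    (B : SimpleGraph (Site 2)) (hB : B ≤ zdGraph 2) (hfin : B.support.Finite)
    {w w' u u' : Site 2} (hww' : B.Adj w w') (hwu : (zdGraph 2).Adj w u)
    (huu' : (zdGraph 2).Adj u u') (hu'w' : (zdGraph 2).Adj u' w')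
    (hu : u ∉ B.support) (hu' : u' ∉ B.support) :
    pathKernel B x w w' ≤ 1 := by
  classical
  -- distinctness
  have hne : ∀ {a b : Site 2}, a ∈ B.support → b ∉ B.support → a ≠ b :=
    fun ha hb hab => hb (hab ▸ ha)
  have hwu_ne : w ≠ u := hwu.ne
  have huu'_ne : u ≠ u' := huu'.ne
  have hu'w'_ne : u' ≠ w' := hu'w'.ne
  have hww'_ne : w ≠ w' := hww'.ne
  have hwu'_ne : w ≠ u' := hne ⟨w', hww'⟩ hu'
  have hw'u_ne : w' ≠ u := hne ⟨w, hww'.symm⟩ hu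
  -- no `B`-edges at `u`, `u'`
  have hBu : ∀ z, ¬ B.Adj u z := fun z hz => hu ⟨z, hz⟩
  have hBu' : ∀ z, ¬ B.Adj u' z := fun z hz => hu' ⟨z, hz⟩
  -- the gadget graph
  obtain ⟨H, hH⟩ : ∃ H : SimpleGraph (Site 2),
      H = B ⊔ SimpleGraph.edge w u ⊔ SimpleGraph.edge u u' ⊔ SimpleGraph.edge u' w' := ⟨_, rfl⟩
  have hHadj : ∀ a b, H.Adj a b ↔ B.Adj a b ∨ ((a = w ∧ b = u ∨ a = u ∧ b = w) ∧ a ≠ b) ∨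
      ((a = u ∧ b = u' ∨ a = u' ∧ b = u) ∧ a ≠ b) ∨ ((a = u' ∧ b = w' ∨ a = w' ∧ b = u') ∧ a ≠ b) := by
    intro a b; rw [hH]; exact gadget_adj B w w' u u' a b
  have hle : B ≤ H := by rw [hH]; exact le_sup_left.trans (le_sup_left.trans le_sup_left)
  have hHzd : H ≤ zdGraph 2 := by
    rw [hH]
    refine sup_le (sup_le (sup_le hB ?_) ?_) ?_
    · exact (SimpleGraph.edge_le_iff _).2 (Or.inr hwu)
    · exact (SimpleGraph.edge_le_iff _).2 (Or.inr huu')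
    · exact (SimpleGraph.edge_le_iff _).2 (Or.inr hu'w')
  -- adjacency facts in `H`
  have hHwu : H.Adj w u := (hHadj w u).2 (Or.inr (Or.inl ⟨Or.inl ⟨rfl, rfl⟩, hwu_ne⟩))
  have hHuu' : H.Adj u u' := (hHadj u u').2 (Or.inr (Or.inr (Or.inl ⟨Or.inl ⟨rfl, rfl⟩, huu'_ne⟩)))
  have hHu'w' : H.Adj u' w' := (hHadj u' w').2 (Or.inr (Or.inr (Or.inr ⟨Or.inl ⟨rfl, rfl⟩, hu'w'_ne⟩)))
  have hHww' : H.Adj w w' := hle hww'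
  -- neighbourhoods of `u` and `u'` in `H`
  have hNu : ∀ z, H.Adj u z ↔ z = w ∨ z = u' := by
    intro z
    constructor
    · intro hz
      rcases (hHadj u z).1 hz with hz | ⟨h', -⟩ | ⟨h', -⟩ | ⟨h', -⟩
      · exact (hBu z hz).elim
      · rcases h' with ⟨h1, -⟩ | ⟨-, h2⟩
        · exact absurd h1.symm hwu_ne
        · exact Or.inl h2
      · rcases h' with ⟨-, h2⟩ | ⟨h1, -⟩
        · exact Or.inr h2
        · exact absurd h1 huu'_ne
      · rcases h' with ⟨h1, -⟩ | ⟨h1, -⟩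
        · exact absurd h1 huu'_ne
        · exact absurd h1.symm hw'u_ne
    · rintro (rfl | rfl)
      · exact hHwu.symm
      · exact hHuu'
  have hNu' : ∀ z, H.Adj u' z ↔ z = u ∨ z = w' := by
    intro z
    constructor
    · intro hz
      rcases (hHadj u' z).1 hz with hz | ⟨h', -⟩ | ⟨h', -⟩ | ⟨h', -⟩
      · exact (hBu' z hz).elim
      · rcases h' with ⟨h1, -⟩ | ⟨h1, -⟩
        · exact absurd h1.symm hwu'_ne
        · exact absurd h1.symm huu'_ne
      · rcases h' with ⟨h1, -⟩ | ⟨-, h2⟩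
        · exact absurd h1.symm huu'_ne
        · exact Or.inl h2
      · rcases h' with ⟨-, h2⟩ | ⟨h1, -⟩
        · exact Or.inr h2
        · exact absurd h1 hu'w'_ne
    · rintro (rfl | rfl)
      · exact hHuu'.symm
      · exact hHu'w'
  -- the vertex-deleted graphs `H - u`, `H - u'`
  set Hu := H.deleteEdges (H.incidenceSet u) with hHu_def
  set Hu' := H.deleteEdges (H.incidenceSet u') with hHu'_def
  have hHu_adj : ∀ a b, Hu.Adj a b ↔ H.Adj a b ∧ a ≠ u ∧ b ≠ u := deleteEdges_incidenceSet_adj H u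
  have hHu'_adj : ∀ a b, Hu'.Adj a b ↔ H.Adj a b ∧ a ≠ u' ∧ b ≠ u' :=
    deleteEdges_incidenceSet_adj H u'
  -- `(H - u) - u' = B = (H - u') - u`
  have hHB : ∀ a b, H.Adj a b → a ≠ u → b ≠ u → a ≠ u' → b ≠ u' → B.Adj a b := by
    intro a b hab hau hbu hau' hbu'
    rcases (hHadj a b).1 hab with h' | ⟨h', -⟩ | ⟨h', -⟩ | ⟨h', -⟩
    · exact h'
    · rcases h' with ⟨-, h2⟩ | ⟨h1, -⟩
      · exact absurd h2 hbu
      · exact absurd h1 hau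
    · rcases h' with ⟨h1, -⟩ | ⟨h1, -⟩
      · exact absurd h1 hau
      · exact absurd h1 hau'
    · rcases h' with ⟨h1, -⟩ | ⟨-, h2⟩
      · exact absurd h1 hau'
      · exact absurd h2 hbu'
  have hBH : ∀ a b, B.Adj a b → H.Adj a b ∧ a ≠ u ∧ b ≠ u ∧ a ≠ u' ∧ b ≠ u' := fun a b hab =>
    ⟨hle hab, hne ⟨b, hab⟩ hu, hne ⟨a, hab.symm⟩ hu, hne ⟨b, hab⟩ hu', hne ⟨a, hab.symm⟩ hu'⟩
  have hB1 : Hu.deleteEdges (Hu.incidenceSet u') = B := by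
    ext a b
    rw [deleteEdges_incidenceSet_adj, hHu_adj]
    constructor
    · rintro ⟨⟨hab, hau, hbu⟩, hau', hbu'⟩
      exact hHB a b hab hau hbu hau' hbu'
    · intro hab
      obtain ⟨h1, h2, h3, h4, h5⟩ := hBH a b hab
      exact ⟨⟨h1, h2, h3⟩, h4, h5⟩
  have hB2 : Hu'.deleteEdges (Hu'.incidenceSet u) = B := by
    ext a b
    rw [deleteEdges_incidenceSet_adj, hHu'_adj]
    constructor
    · rintro ⟨⟨hab, hau', hbu'⟩, hau, hbu⟩
      exact hHB a b hab hau hbu hau' hbu'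
    · intro hab
      obtain ⟨h1, h2, h3, h4, h5⟩ := hBH a b hab
      exact ⟨⟨h1, h4, h5⟩, h2, h3⟩
  -- neighbour sets
  have hN_u : H.neighborSet u = {w, u'} := by
    ext z
    rw [SimpleGraph.mem_neighborSet, hNu z, Set.mem_insert_iff, Set.mem_singleton_iff]
  have hN_u' : H.neighborSet u' = {u, w'} := by
    ext z
    rw [SimpleGraph.mem_neighborSet, hNu' z, Set.mem_insert_iff, Set.mem_singleton_iff]
  have hN_u'_Hu : Hu.neighborSet u' = {w'} := by
    ext z
    rw [SimpleGraph.mem_neighborSet, hHu_adj, hNu' z, Set.mem_singleton_iff]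
    constructor
    · rintro ⟨hz | hz, -, hzu⟩
      · exact absurd hz hzu
      · exact hz
    · rintro rfl
      exact ⟨Or.inr rfl, huu'_ne.symm, hw'u_ne⟩
  have hN_u_Hu' : Hu'.neighborSet u = {w} := by
    ext z
    rw [SimpleGraph.mem_neighborSet, hHu'_adj, hNu z, Set.mem_singleton_iff]
    constructor
    · rintro ⟨hz | hz, -, hzu'⟩
      · exact hz
      · exact absurd hz hzu'
    · rintro rfl
      exact ⟨Or.inl rfl, huu'_ne, hwu'_ne⟩
  -- leaves: in `H - u` the only neighbour of `u'` is `w'`; in `H - u'` the only neighbour of `u` is `w`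
  have hleaf_u' : ∀ z, Hu.Adj u' z → z = w' := fun z hz => by
    have hz' : z ∈ Hu.neighborSet u' := hz
    rwa [hN_u'_Hu, Set.mem_singleton_iff] at hz'
  have hleaf_u : ∀ z, Hu'.Adj u z → z = w := fun z hz => by
    have hz' : z ∈ Hu'.neighborSet u := hz
    rwa [hN_u_Hu', Set.mem_singleton_iff] at hz'
  -- the four gadget kernels in terms of `z = Z_B(w,w')`
  have hxle : 0 ≤ x := hx0.le
  set z := pathKernel B x w w' with hz_def
  have K1 : pathKernel H x u w = ENNReal.ofReal x * (1 + ENNReal.ofReal x * z) := by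
    rw [pathKernel_firstStep_pair H x hxle hwu_ne.symm hwu'_ne hN_u, pathKernel_self,
      pathKernel_firstStep_single Hu x hxle hwu'_ne.symm hN_u'_Hu, hB1, pathKernel_comm B x w' w]
  have K2 : pathKernel H x u w' = ENNReal.ofReal x * (z + ENNReal.ofReal x) := by
    rw [pathKernel_firstStep_pair H x hxle hw'u_ne.symm hwu'_ne hN_u,
      pathKernel_eq_deleteVert_of_leaf Hu x hleaf_u' hwu'_ne hu'w'_ne.symm, hB1,
      pathKernel_firstStep_single Hu x hxle hu'w'_ne hN_u'_Hu, hB1, pathKernel_self, mul_one]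
  have K3 : pathKernel H x u' w' = ENNReal.ofReal x * (ENNReal.ofReal x * z + 1) := by
    rw [pathKernel_firstStep_pair H x hxle hu'w'_ne hw'u_ne.symm hN_u',
      pathKernel_firstStep_single Hu' x hxle hw'u_ne.symm hN_u_Hu', hB2, pathKernel_self]
  have K4 : pathKernel H x u' w = ENNReal.ofReal x * (ENNReal.ofReal x + z) := by
    rw [pathKernel_firstStep_pair H x hxle hwu'_ne.symm hw'u_ne.symm hN_u',
      pathKernel_firstStep_single Hu' x hxle hwu_ne.symm hN_u_Hu', hB2, pathKernel_self, mul_one,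
      pathKernel_eq_deleteVert_of_leaf Hu' x hleaf_u hw'u_ne hwu_ne, hB2, pathKernel_comm B x w' w]
  -- hypotheses of the core for the quadruple `(u, w, w', u')` of `H`
  have hHfin : H.support.Finite := by
    refine (hfin.union ((((Set.finite_singleton w').insert u').insert u).insert w)).subset ?_
    rintro a ⟨b, hab⟩
    rcases (hHadj a b).1 hab with h' | ⟨h', -⟩ | ⟨h', -⟩ | ⟨h', -⟩
    · exact Or.inl ⟨b, h'⟩
    · right; rcases h' with ⟨rfl, -⟩ | ⟨rfl, -⟩ <;> simp
    · right; rcases h' with ⟨rfl, -⟩ | ⟨rfl, -⟩ <;> simp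
    · right; rcases h' with ⟨rfl, -⟩ | ⟨rfl, -⟩ <;> simp
  have hI : Interlaced H u w w' u' := by
    intro P Q
    obtain ⟨v, hadj, q, hq⟩ := SimpleGraph.Walk.exists_eq_cons_of_ne hwu'_ne.symm Q.1.reverse
    have hvQ : v ∈ Q.1.support := by
      have hmem : v ∈ Q.1.reverse.support := by
        rw [hq, SimpleGraph.Walk.support_cons]
        exact List.mem_cons_of_mem _ q.start_mem_support
      rwa [SimpleGraph.Walk.support_reverse, List.mem_reverse] at hmem
    rcases (hNu' v).1 hadj with rfl | rfl
    · exact ⟨_, P.1.start_mem_support, hvQ⟩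
    · exact ⟨_, P.1.end_mem_support, hvQ⟩
  have hD1 : DisjointPaths H u w w' u' := by
    refine ⟨SimpleGraph.Path.singleton hHwu.symm, SimpleGraph.Path.singleton hHu'w'.symm, ?_⟩
    simp only [SimpleGraph.Path.singleton_coe, SimpleGraph.Walk.support_cons,
      SimpleGraph.Walk.support_nil]
    intro a ha hb
    simp only [List.mem_cons, List.not_mem_nil, or_false] at ha hb
    rcases ha with rfl | rfl <;> rcases hb with h | h
    exacts [hw'u_ne h.symm, huu'_ne h, hww'_ne h, hwu'_ne h]
  have hD2 : DisjointPaths H u u' w w' := by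
    refine ⟨SimpleGraph.Path.singleton hHuu', SimpleGraph.Path.singleton hHww', ?_⟩
    simp only [SimpleGraph.Path.singleton_coe, SimpleGraph.Walk.support_cons,
      SimpleGraph.Walk.support_nil]
    intro a ha hb
    simp only [List.mem_cons, List.not_mem_nil, or_false] at ha hb
    rcases ha with rfl | rfl <;> rcases hb with h | h
    exacts [hwu_ne h.symm, hw'u_ne h.symm, hwu'_ne h.symm, hu'w'_ne h]
  -- apply the core and evaluate
  have key := h H hHzd hHfin u w w' u' hI hD1 hD2
  rw [pathKernel_comm H x w u', pathKernel_comm H x w' u', K1, K2, K3, K4] at key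
  have hz_top : z ≠ ⊤ := pathKernel_ne_top hfin x w w'
  have hzζ : z = ENNReal.ofReal z.toReal := (ENNReal.ofReal_toReal hz_top).symm
  set ζ := z.toReal with hζ_def
  have hζ0 : 0 ≤ ζ := ENNReal.toReal_nonneg
  rw [hzζ] at key ⊢
  have e1 : ENNReal.ofReal x * (ENNReal.ofReal ζ + ENNReal.ofReal x) =
      ENNReal.ofReal (x * (ζ + x)) := by rw [← ENNReal.ofReal_add hζ0 hxle, ← ENNReal.ofReal_mul hxle]
  have e2 : ENNReal.ofReal x * (ENNReal.ofReal x + ENNReal.ofReal ζ) =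
      ENNReal.ofReal (x * (x + ζ)) := by rw [← ENNReal.ofReal_add hxle hζ0, ← ENNReal.ofReal_mul hxle]
  have e3 : ENNReal.ofReal x * (1 + ENNReal.ofReal x * ENNReal.ofReal ζ) =
      ENNReal.ofReal (x * (1 + x * ζ)) := by
    rw [← ENNReal.ofReal_mul hxle, ← ENNReal.ofReal_one, ← ENNReal.ofReal_add zero_le_one
      (mul_nonneg hxle hζ0), ← ENNReal.ofReal_mul hxle]
  have e4 : ENNReal.ofReal x * (ENNReal.ofReal x * ENNReal.ofReal ζ + 1) =
      ENNReal.ofReal (x * (x * ζ + 1)) := by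
    rw [← ENNReal.ofReal_mul hxle, ← ENNReal.ofReal_one, ← ENNReal.ofReal_add
      (mul_nonneg hxle hζ0) zero_le_one, ← ENNReal.ofReal_mul hxle]
  rw [e1, e2, e3, e4, ← ENNReal.ofReal_mul (mul_nonneg hxle (add_nonneg hζ0 hxle)),
    ← ENNReal.ofReal_mul (mul_nonneg hxle (add_nonneg zero_le_one (mul_nonneg hxle hζ0))),
    ENNReal.ofReal_le_ofReal_iff (by positivity)] at key
  -- `key : x (ζ + x) · x (x + ζ) ≤ x (1 + x ζ) · x (x ζ + 1)` over `ℝ`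
  have eqL : x * (ζ + x) * (x * (x + ζ)) = x ^ 2 * (ζ + x) ^ 2 := by ring
  have eqR : x * (1 + x * ζ) * (x * (x * ζ + 1)) = x ^ 2 * (1 + x * ζ) ^ 2 := by ring
  rw [eqL, eqR] at key
  have h3 : (ζ + x) ^ 2 ≤ (1 + x * ζ) ^ 2 := le_of_mul_le_mul_left key (by positivity)
  have h4 : ζ + x ≤ 1 + x * ζ :=
    (pow_le_pow_iff_left₀ (by positivity) (by positivity) two_ne_zero).1 h3
  have h5 : ζ ≤ 1 := by nlinarith [h4, hx0, hx1]
  calc ENNReal.ofReal ζ ≤ ENNReal.ofReal 1 := ENNReal.ofReal_le_ofReal h5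
    _ = 1 := ENNReal.ofReal_one

end Summit.CriticalPhenomena.SAWScalingLimit.Theorems.BoundaryTP2
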